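import Summits.CriticalPhenomena.PercolationContinuityZ3.Theorems.PercNearOneGluingNoHeavyLowerTailSunflowerTypeModelDecoding
import Mathlib.Data.List.Permutation
import Mathlib.Data.Fintype.Pi
import Mathlib.Data.Finset.Powerset
import Mathlib.Data.Finset.Sigma
import Mathlib.Data.Nat.Factorial.Basic
import Mathlib.Algebra.Order.BigOperators.Group.Finset
import HarnessLib

/-!
# `NoHeavyLowerTail` (crux stmt-CriticalPhenomena-4575), abstract sunflower cubic: TYPE MODEL, part 5 — KEYS and THE TYPE-MODEL LEMMA

Support file (seat `prim-ineq-prove-1` gen 40; `--supports stmt-CriticalPhenomena-4575`).  No `sorry`, no named facts.  Memo: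
run/shared/lean/prim/prim-ineq-prove-1/FINDING-BIPARTITE-prove1-g40.md (§3 the type model, §4 the injection Ψ).

THE PROGRAMME.  THEOREM (memo): every BIPARTITE graph core `edgeCore Γ` is A-safe (Lemma A for every number of petals and every
product measure).  Polarisation + symmetrisation + conditioning on one side of the bipartition reduce it to the purely finite
TYPE-MODEL LEMMA `TypeModel.Model.typeModel_lemma` (file `…SunflowerTypeModelLemma`): for K slots, elements with killer types
`τ x ⊆ [K]` and multiplicities, petal labels and an orientation digraph `O`, one has, for every multiplicity profile,
`Σ_{BAD S} (K − |nonA S|)! ≤ (K−1)!·#GOOD`.  The proof is an explicit injection `(S, enumeration) ↦ (Ψ S, key)`: rotate the contents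
of the non-A slots along a Hamiltonian path of `O|_N` whose start dominates its end (else its last-but-one), strip the new Z-slot,
and encode the path reversed in front of the enumeration.

THIS FILE (part 5).  `cpath`, `key S L = (cpath S).reverse ++ L.drop |cpath S|`; **`psi_key_injective`**: on BAD configurations the
map `(S, L) ↦ (Ψ S, key S L)` (over enumerations `L` of the slots extending the canonical path) is injective (via part 4:
equal keys force one path to be a suffix of the other; a proper suffix is impossible, an equal one forces the same non-A set, the same
canonical plan, and then decoding); `key_perm_and_head`.  COUNTING: `enumsOf B` (listings of a finset, `card = |B|!` via
`List.permutations`), `confs m` (configurations of profile `m`), `badKeys`/`goodKeys`, `card_badKeys_le`, the fibre bounds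
`le_card_fiber_bad` (`≥ (K−|N|)!`), `card_fiber_good_le` (`≤ (K−1)!`), and
**`typeModel_lemma : Σ_{S ∈ confs m, Bad S} (K − |nonA S|)! ≤ (K−1)! · #{S ∈ confs m | Good S}`**.
-/

namespace Summit.CriticalPhenomena.PercolationContinuityZ3.Theorems.SunflowerPartition

namespace TypeModel

open Finset Literature.Combinatorics.Digraph

variable {K : ℕ} {ι : Type*} {Λ : Type*}

namespace Model

variable {M : Model K ι Λ} {S : ι → Finset (Fin K)}

/-! ### Keys and the injectivity of `(S, L) ↦ (Ψ S, key S L)` -/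

section Keys

/-- The canonical path (as a list of slots) of a configuration; `[]` if there is no plan. [this work] -/
noncomputable def cpath (S : ι → Finset (Fin K)) : List (Fin K) :=
  match M.canon (M.nonA S) with
  | none => []
  | some P => P.path

/-- The KEY transformation on slot enumerations: the path prefix is replaced by its reverse. [this work] -/
noncomputable def key (S : ι → Finset (Fin K)) (L : List (Fin K)) : List (Fin K) :=
  (M.cpath S).reverse ++ L.drop (M.cpath S).length

/-- `cpath` is the canonical plan's path. [this work] -/
theorem cpath_eq {P : M.Plan (M.nonA S)} (hP : M.canon (M.nonA S) = some P) : M.cpath S = P.path := by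
  unfold cpath; rw [hP]

/-- `psi` is `psiWith` of the canonical plan. [this work] -/
theorem psi_eq {P : M.Plan (M.nonA S)} (hP : M.canon (M.nonA S) = some P) : M.psi S = M.psiWith P S := by
  unfold psi; rw [hP]

/-- `psi_eq` with the non-A set generalised (avoids dependent rewriting). -/
theorem psi_eq_of_canon_eq {N : Finset (Fin K)} (hN : M.nonA S = N) {P : M.Plan N} (hP : M.canon N = some P) :
    M.psi S = M.psiWith P S := by
  subst hN; unfold psi; rw [hP]

/-- `nonA` is determined by the path of any plan. -/
theorem nonA_eq_toFinset_path {N : Finset (Fin K)} (P : M.Plan N) : N = P.path.toFinset := by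
  ext k; rw [List.mem_toFinset, P.mem_path_iff]

/-- **Injectivity of the keyed map** on BAD configurations: if `Ψ S = Ψ S'` and `key S L = key S' L'` for enumerations
`L ⊒ cpath S`, `L' ⊒ cpath S'`, then `S = S'` and `L = L'`. [this work] -/
theorem psi_key_injective {S' : ι → Finset (Fin K)} (hS : M.Bad S) (hS' : M.Bad S') {L L' : List (Fin K)}
    (hL : M.cpath S <+: L) (hL' : M.cpath S' <+: L') (hg : M.psi S = M.psi S') (hk : M.key S L = M.key S' L') :
    S = S' ∧ L = L' := by
  classical
  obtain ⟨P, hP⟩ := canon_isSome_of_bad hS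
  obtain ⟨P', hP'⟩ := canon_isSome_of_bad hS'
  rw [psi_eq hP, psi_eq hP'] at hg
  unfold key at hk
  rw [cpath_eq hP] at hk hL
  rw [cpath_eq hP'] at hk hL'
  obtain ⟨R, rfl⟩ := hL
  obtain ⟨R', rfl⟩ := hL'
  simp only [List.drop_left] at hk
  -- compare the two keys
  rcases List.append_eq_append_iff.1 hk with ⟨A, hA, hR⟩ | ⟨B, hB, hR'⟩
  · -- P'.path.reverse = P.path.reverse ++ A, so P'.path = A.reverse ++ P.path
    have hpath : P'.path = A.reverse ++ P.path := by
      have := congrArg List.reverse hA; simpa using this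
    by_cases hA0 : A = []
    · subst hA0
      simp only [List.reverse_nil, List.nil_append] at hpath hR
      -- same path ⇒ same non-A set ⇒ same plan ⇒ decoding
      have hNN : M.nonA S' = M.nonA S := by
        rw [nonA_eq_toFinset_path P', nonA_eq_toFinset_path P, hpath]
      have hg' : M.psiWith P S = M.psiWith P S' := by
        have e1 : M.psi S' = M.psiWith P S' := psi_eq_of_canon_eq (S := S') hNN hP
        rw [← e1, psi_eq hP'] ; exact hg
      have hSS : S = S' := psiWith_injective (S := S) P rfl (by rw [hNN]) hg'
      subst hSS
      refine ⟨rfl, ?_⟩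
      rw [hR]
      -- P = P' as the canonical plan of the same set; their paths agree anyway
      rw [hpath]
    · exact absurd hg (psiWith_ne_of_suffix (S := S) (S' := S') P P' A.reverse hpath rfl rfl hS hS'
        (by simpa using hA0))
  · have hpath : P.path = B.reverse ++ P'.path := by
      have := congrArg List.reverse hB; simpa using this
    by_cases hB0 : B = []
    · subst hB0
      simp only [List.reverse_nil, List.nil_append] at hpath hR'
      have hNN : M.nonA S = M.nonA S' := by
        rw [nonA_eq_toFinset_path P', nonA_eq_toFinset_path P, hpath]
      have hg' : M.psiWith P' S' = M.psiWith P' S := by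
        have e1 : M.psi S = M.psiWith P' S := psi_eq_of_canon_eq (S := S) hNN hP'
        rw [← e1, psi_eq hP] ; exact hg.symm
      have hSS : S' = S := psiWith_injective (S := S') P' rfl (by rw [hNN]) hg'
      subst hSS
      refine ⟨rfl, ?_⟩
      rw [hR', hpath]
    · exact absurd hg.symm (psiWith_ne_of_suffix (S := S') (S' := S) P' P B.reverse hpath rfl rfl hS' hS
        (by simpa using hB0))

/-- The key of a BAD configuration is a permutation of the enumeration and starts with the Z-slot of `Ψ S`. [this work] -/
theorem key_perm_and_head (hS : M.Bad S) {L : List (Fin K)} (hL : M.cpath S <+: L) :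
    (M.key S L).Perm L ∧ ∃ z, M.nonA (M.psi S) = {z} ∧ (M.key S L).head? = some z := by
  classical
  obtain ⟨P, hP⟩ := canon_isSome_of_bad hS
  unfold key; rw [cpath_eq hP] at hL ⊢
  obtain ⟨R, rfl⟩ := hL
  simp only [List.drop_left]
  refine ⟨(List.reverse_perm _).append_right R, P.z, ?_, ?_⟩
  · rw [psi_eq hP]; exact (good_psiWith (S := S) P rfl hS).1
  · rw [P.path_eq_append_z]; simp

end Keys
/-! ### Counting: the type-model lemma -/

section Counting

variable (M) [Fintype ι] [DecidableEq ι]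

open Nat

/-- The enumerations (repetition-free listings) of a finset, as a finset of lists. [this work] -/
noncomputable def enumsOf (B : Finset (Fin K)) : Finset (List (Fin K)) := B.toList.permutations.toFinset

omit [Fintype ι] [DecidableEq ι] in
/-- Membership in `enumsOf`. [this work] -/
theorem mem_enumsOf {B : Finset (Fin K)} {L : List (Fin K)} :
    L ∈ enumsOf B ↔ L.Nodup ∧ ∀ k, k ∈ L ↔ k ∈ B := by
  unfold enumsOf
  rw [List.mem_toFinset, List.mem_permutations]
  constructor
  · intro h
    exact ⟨h.nodup_iff.2 (Finset.nodup_toList B), fun k => by rw [h.mem_iff, Finset.mem_toList]⟩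
  · rintro ⟨hnd, hmem⟩
    exact (List.perm_ext_iff_of_nodup hnd (Finset.nodup_toList B)).2 fun k => by rw [hmem, Finset.mem_toList]

omit [Fintype ι] [DecidableEq ι] in
/-- `|enumsOf B| = |B|!`. [this work] -/
theorem card_enumsOf (B : Finset (Fin K)) : (enumsOf B).card = B.card ! := by
  unfold enumsOf
  rw [List.toFinset_card_of_nodup (List.nodup_permutations _ (Finset.nodup_toList B)), List.length_permutations,
    Finset.length_toList]

/-- Configurations with multiplicity profile `m`. [this work] -/
noncomputable def confs (m : ι → ℕ) : Finset (ι → Finset (Fin K)) :=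
  Fintype.piFinset fun x => (univ : Finset (Fin K)).powersetCard (m x)

/-- Membership in `confs m`. [this work] -/
theorem mem_confs {m : ι → ℕ} {S : ι → Finset (Fin K)} : S ∈ confs m ↔ ∀ x, (S x).card = m x := by
  unfold confs; simp [Fintype.mem_piFinset, Finset.mem_powersetCard]

/-- Domain of the injection: BAD configurations of profile `m` with an enumeration of the slots extending the canonical
path. [this work] -/
noncomputable def badKeys (m : ι → ℕ) : Finset (Σ _ : ι → Finset (Fin K), List (Fin K)) := by
  classical
  exact ((confs m).filter fun S => M.Bad S).sigma fun S => (enumsOf univ).filter fun L => M.cpath S <+: L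

/-- Codomain: GOOD configurations of profile `m` with an enumeration of the slots starting at the Z-slot. [this work] -/
noncomputable def goodKeys (m : ι → ℕ) : Finset (Σ _ : ι → Finset (Fin K), List (Fin K)) := by
  classical
  exact ((confs m).filter fun S => M.Good S).sigma fun S =>
    (enumsOf univ).filter fun L => ∃ z, M.nonA S = {z} ∧ L.head? = some z

/-- The keyed map `(S, L) ↦ (Ψ S, key S L)` sends `badKeys` injectively into `goodKeys`. [this work] -/
theorem card_badKeys_le (m : ι → ℕ) : (M.badKeys m).card ≤ (M.goodKeys m).card := by
  classical
  refine Finset.card_le_card_of_injOn (fun SL => ⟨M.psi SL.1, M.key SL.1 SL.2⟩) ?_ ?_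
  · intro SL hSL
    obtain ⟨S, L⟩ := SL
    simp only [badKeys, Finset.mem_sigma, Finset.mem_filter, Finset.mem_coe] at hSL
    obtain ⟨⟨hSc, hSb⟩, hLe, hpre⟩ := hSL
    simp only [goodKeys, Finset.mem_coe, Finset.mem_sigma, Finset.mem_filter]
    obtain ⟨hperm, z, hz, hhead⟩ := key_perm_and_head (S := S) hSb hpre
    refine ⟨⟨?_, good_psi hSb⟩, ?_, z, hz, hhead⟩
    · rw [mem_confs] at hSc ⊢; intro x; rw [card_psi hSb, hSc]
    · rw [mem_enumsOf] at hLe ⊢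
      exact ⟨hperm.nodup_iff.2 hLe.1, fun k => by rw [hperm.mem_iff]; exact hLe.2 k⟩
  · rintro ⟨S, L⟩ hSL ⟨S', L'⟩ hSL' h
    simp only [badKeys, Finset.mem_sigma, Finset.mem_filter, Finset.mem_coe] at hSL hSL'
    simp only [Sigma.mk.injEq] at h
    obtain ⟨h1, h2⟩ := h
    obtain ⟨hSS, hLL⟩ := psi_key_injective (S := S) hSL.1.2 hSL'.1.2 hSL.2.2 hSL'.2.2 h1 (eq_of_heq h2)
    subst hSS; subst hLL; rfl

omit [Fintype ι] [DecidableEq ι] in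
/-- Lower bound for the fibres of `badKeys`: at least `(K - |N|)!` enumerations extend the canonical path. [this work] -/
theorem le_card_fiber_bad {S : ι → Finset (Fin K)} (hS : M.Bad S) :
    (K - (M.nonA S).card) ! ≤ ((enumsOf univ).filter fun L => M.cpath S <+: L).card := by
  classical
  obtain ⟨P, hP⟩ := canon_isSome_of_bad (M := M) hS
  have hN : M.nonA S = P.path.toFinset := nonA_eq_toFinset_path P
  have hcard : (univ \ M.nonA S).card = K - (M.nonA S).card := by
    rw [Finset.card_sdiff_of_subset (Finset.subset_univ _), Finset.card_univ, Fintype.card_fin]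
  rw [← hcard, ← card_enumsOf]
  refine Finset.card_le_card_of_injOn (fun R => M.cpath S ++ R) ?_ ?_
  · intro R hR
    rw [Finset.mem_coe, mem_enumsOf] at hR
    simp only [Finset.mem_coe, Finset.mem_filter, mem_enumsOf, cpath_eq hP]
    refine ⟨⟨?_, fun k => ?_⟩, List.prefix_append _ _⟩
    · refine List.Nodup.append P.nodup_path hR.1 fun k hk hk' => ?_
      have := (hR.2 k).1 hk'
      rw [Finset.mem_sdiff, hN, List.mem_toFinset] at this
      exact this.2 hk
    · simp only [List.mem_append, Finset.mem_univ, iff_true]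
      by_cases hk : k ∈ P.path
      · exact Or.inl hk
      · right; rw [hR.2 k, Finset.mem_sdiff, hN, List.mem_toFinset]; exact ⟨Finset.mem_univ _, hk⟩
  · intro R _ R' _ h
    exact List.append_cancel_left h

omit [Fintype ι] [DecidableEq ι] in
/-- Upper bound for the fibres of `goodKeys`: at most `(K-1)!` enumerations start at the Z-slot. [this work] -/
theorem card_fiber_good_le {S : ι → Finset (Fin K)} :
    ((enumsOf univ).filter fun L => ∃ z, M.nonA S = {z} ∧ L.head? = some z).card ≤ (K - 1) ! := by
  classical
  by_cases hz : ∃ z, M.nonA S = {z}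
  · obtain ⟨z, hz⟩ := hz
    have hcard : (univ.erase z).card = K - 1 := by
      rw [Finset.card_erase_of_mem (Finset.mem_univ _), Finset.card_univ, Fintype.card_fin]
    rw [← hcard, ← card_enumsOf]
    refine Finset.card_le_card_of_injOn List.tail ?_ ?_
    · intro L hL
      simp only [Finset.mem_coe, Finset.mem_filter, mem_enumsOf, hz, Finset.singleton_inj, exists_eq_left'] at hL
      obtain ⟨⟨hnd, hmem⟩, hhead⟩ := hL
      obtain ⟨t, rfl⟩ : ∃ t, L = z :: t := by
        cases L with
        | nil => simp at hhead
        | cons a t => simp only [List.head?_cons, Option.some.injEq] at hhead; exact ⟨t, by rw [hhead]⟩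
      rw [Finset.mem_coe, mem_enumsOf]
      refine ⟨(List.nodup_cons.1 hnd).2, fun k => ?_⟩
      rw [Finset.mem_erase]
      constructor
      · intro hk; exact ⟨fun h => (List.nodup_cons.1 hnd).1 (h ▸ hk), Finset.mem_univ _⟩
      · rintro ⟨hkz, -⟩
        exact (List.mem_cons.1 ((hmem k).2 (Finset.mem_univ k))).resolve_left hkz
    · intro L hL L' hL' h
      simp only [Finset.mem_coe, Finset.mem_filter, hz, Finset.singleton_inj, exists_eq_left'] at hL hL'
      cases L with
      | nil => simp at hL
      | cons a t =>
        cases L' with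
        | nil => simp at hL'
        | cons a' t' =>
          simp only [List.head?_cons, Option.some.injEq] at hL hL'
          simp only [List.tail_cons] at h
          rw [hL.2, hL'.2, h]
  · have : ((enumsOf univ).filter fun L => ∃ z, M.nonA S = {z} ∧ L.head? = some z) = ∅ := by
      ext L; simp only [Finset.mem_filter, Finset.notMem_empty, iff_false, not_and]
      rintro - ⟨z, hz', -⟩; exact hz ⟨z, hz'⟩
    rw [this, Finset.card_empty]; exact Nat.zero_le _

open scoped Classical in
/-- **THE TYPE-MODEL LEMMA** (g40 memo §4): for every multiplicity profile `m`,
`Σ_{BAD S} (K - |nonA S|)! ≤ (K-1)! · #GOOD`. [this work] -/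
theorem typeModel_lemma (m : ι → ℕ) :
    ∑ S ∈ (confs m).filter (fun S => M.Bad S), (K - (M.nonA S).card) ! ≤
      (K - 1) ! * ((confs m).filter fun S => M.Good S).card := by
  classical
  have h1 : ∑ S ∈ (confs m).filter (fun S => M.Bad S), (K - (M.nonA S).card) ! ≤ (M.badKeys m).card := by
    unfold badKeys; rw [Finset.card_sigma]
    exact Finset.sum_le_sum fun S hS => M.le_card_fiber_bad (Finset.mem_filter.1 hS).2
  have h2 : (M.goodKeys m).card ≤ (K - 1) ! * ((confs m).filter fun S => M.Good S).card := by
    unfold goodKeys; rw [Finset.card_sigma, mul_comm]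
    exact Finset.sum_le_card_nsmul _ _ _ fun S _ => M.card_fiber_good_le
  exact h1.trans ((M.card_badKeys_le m).trans h2)

end Counting

end Model

end TypeModel

end Summit.CriticalPhenomena.PercolationContinuityZ3.Theorems.SunflowerPartition
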